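import Summits.BirchSwinnertonDyer.BirchSwinnertonDyer.Theorems.ThetaPartnerAtTwoSignedControlAtTwoRelaxedKummerCountMultiPlace
import Summits.BirchSwinnertonDyer.BirchSwinnertonDyer.Theorems.ThetaPartnerAtTwoSignedControlAtTwoRelaxedKummerCountRelative
import Summits.BirchSwinnertonDyer.BirchSwinnertonDyer.Theorems.ThetaPartnerAtTwoSignedControlAtTwoH1SigmaDualNotTorsionAdapters
import Summits.BirchSwinnertonDyer.BirchSwinnertonDyer.Theorems.QuadraticBranchSignedControlEtaLayerClassical
import Summits.BirchSwinnertonDyer.Rank1Residual.Additive.ZpTowerSeam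
import Literature.NumberTheory.EllipticCurves.IwasawaSelmerSupersingularSplit
import HarnessLib

/-!
# (I1) `relaxedSelmer_torsion_card_growth` AT EVERY LAYER FROM POITOU–TATE: transport from the layer field `K_n`
# to `H¹(Gal(K̄/K_n), E[p^∞]) = W.subgroupH1 p (κ.layerSubgroup n)`, and assembly

Routes TP2 / RTT, PUB conjunction `PublishedInputsGreenbergControlAtTwo` (stmt-BirchSwinnertonDyer-24143, conj. 5
`h1SigmaInfty_rank_eq_one` via `…H1SigmaNotTorsionOfRelaxed`) and K4 `SignedControlAtTwo` (stmt-BirchSwinnertonDyer-20309);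
seat `bsd-inputs-r1-p1` (D-0154 (2) INPUTS row 1, input (I1) = Greenberg LNM 1716 Thm. 1.7 / p. 62 finite-level count, the
tree named fact `WeierstrassCurve.relaxedSelmer_torsion_card_growth`, "NOT proved in the tree (no global duality yet)").
Third file after `…RelaxedKummerCountMultiPlace` (multi-place PT count) and `…RelaxedKummerCountRelative` (`p^{k[L:F]} ≤ ∏_{w∣v} #(𝓞_{L,w}/p^k)`).

* §0 `prime_pow_mul_finrank_le_natCard_kummerOutside_mul` — Side A over a layer `L ⊇ F`:
  `p^{k·[L:F]} ≤ #kummerOutside E_L (p^k) {w ∣ v} · ∏_{w∣∞} #H¹(L_w, E_L)` from `poitouTate_selmerStructure_duality L`.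
* §1 `conjH1_subgroupH1Iso_mem_localKerOver_adicCompletion` / `…_infinitePlace` — PLACE-WISE base change of the classical local
  conditions along cell `bsd-potss`'s `subgroupH1Iso : H¹(res⁻¹ U, E_L[p^∞]) ≃ H¹(U, E[p^∞])` (`L/K` Galois, `U ≤ galRange L`
  normal): the condition at every place `w ∣ u` of `L` (all `Γ_L`-conjugates) gives the condition at `u` for every
  `Γ_K`-conjugate — every `K`-embedding `K̄ → K̄_u` has a package at some `w ∣ u` (`EtaLayer.exists_package_adicCompletion` /
  `_infinitePlace`, Neukirch II §8) along which the condition is an iff (`EtaLayer.subgroupH1Iso_mem_localKerOverOfEmb_iff`).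
* §2 `exists_finset_subgroupH1_of_kummerOutside` — over ONE number field `L`: `kummerOutside E_L (p^k) S ⊆ H¹(L, E_L[p^k])` maps
  into `H¹(H, E_L[p^∞])` for any subgroup `H ∋` everything, onto `p^k`-torsion classes with the classical conditions at every
  place outside `S` (all conjugates), losing at most `#E_L(L̄)[p^∞]^{Γ_L}` (the level-`0` argument of `…RelaxedKummerCountLevelZero`).
* §3 **`relaxedSelmer_torsion_card_growth_of_poitouTate : (∀ L number field, poitouTate_selmerStructure_duality L) →
  relaxedSelmer_torsion_card_growth`** — (I1) VERBATIM at every layer from the ONE generic global-duality fact (used over the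
  layers `K_n` only): `L = κ.layer n` (`[K_n:K] = pⁿ`, `ZpExtension.finrank_layer_holds`), the SEAM `galRange K_n = κ.layerSubgroup n`
  (`ZpTower.galRange_layer_eq_layerSubgroup`), §0 with `T = {w ∣ v𝓞_{K_n}}`, §2 with `H = res⁻¹(κ.layerSubgroup n) ∋` everything,
  `subgroupH1Iso`, §1 at every finite `u ≠ v` (a place of `K_n` above `u` is not above `v`) and every infinite place;
  `c(n) = #E(K̄)[p^∞]^{Γ_{K_n}} · ∏_{w∣∞} #H¹(K_{n,w}, E)`.
* §4 corollaries BY NAME: `not_isTorsion_of_supersingular_of_poitouTate` (Greenberg Thm. 1.7, supersingular case, from PT over the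
  layers + (I2) Coates–Greenberg, tree assembly `not_isTorsion_of_supersingular_holds_of`), `h1SigmaDualNotTorsion_of_poitouTate_layers`
  (the K4 door predicate for EVERY curve, no `E(K)[p] = 0` hypothesis — complement of the twist road).

HONEST FRAMING: THEOREMS ONLY (no definition, no named fact, no `sorry`), CONDITIONAL on the named Poitou–Tate fact
`poitouTate_selmerStructure_duality` over the layers `K_n` (a `conditional-result`: (I1) is REDUCED to generic PT, not
discharged); no item is closed by this file. BSD is not proved by any of this.

References: [cite: GreenbergLNM1716, Thm 1.7 and the paragraph after it (pp. 61–62), §2 (pp. 62–63), §3 Lemma 3.1, §4 p. 113]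
[cite: MilneADT2006, Ch. I, Thm. 4.10] [cite: NeukirchSchmidtWingberg2008, (8.7.9)] [cite: NeukirchANT1999, Ch. II §8]
[cite: Washington1997, §13.1] [cite: SerreGaloisCohomology1997, I.§2.4, II.§1.1].
-/

set_option linter.dupNamespace false

noncomputable section
open scoped Classical
open CategoryTheory Field NumberField IsDedekindDomain Function
open Literature.NumberTheory.EllipticCurves Literature.NumberTheory.EllipticCurves.GreenbergSelmer
open Literature.NumberTheory.GaloisRepresentations
open Literature.NumberTheory.GaloisRepresentations.DiscreteGaloisModule (SelmerStructure tateDual)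
open Literature.NumberTheory.GaloisCohomology
open scoped ContRepresentation
namespace Summit.BirchSwinnertonDyer.BirchSwinnertonDyer.Theorems.SignedEC.RelaxedKummerCount

open Summit.BirchSwinnertonDyer.Rank1Residual.X11b.KummerPT Summit.BirchSwinnertonDyer.Rank1Residual.X11b.LocBridge
  Summit.BirchSwinnertonDyer.Rank1Residual.X11b.Levels Summit.BirchSwinnertonDyer.Rank1Residual.X11b.AcSelmer
  Summit.BirchSwinnertonDyer.Rank1Residual.X11b.SelmerLevelBound

variable {K : Type} [Field K] [NumberField K] (W : WeierstrassCurve K) [W.IsElliptic] (p : ℕ) [Fact p.Prime]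

/-! ## §0 Side A over the layer, assembled: `p^{k·[L:F]} ≤ #H¹_{𝓛, ⊤ above v}(L, E_L[p^k]) · C_∞(L)` -/

section SideA

variable (F L : Type) [Field F] [NumberField F] [Field L] [NumberField L] [Algebra F L]

/-- **Side A of (I1) at every layer, assembled: `p^{k·[L:F]} ≤ #H¹_{𝓛, ⊤ at T}(L, E_L[p^k]) · ∏_{w∣∞} #H¹(L_w, E_L)`**
for `E_L = W'` elliptic over a number field `L ⊇ F`, a place `v ∋ p` of `F` and a finite set `T` of finite
places of `L` containing every `w ∣ v𝓞_L` (in the application `L = K_n`, `[L:F] = pⁿ`, `T = {w ∣ v}`), GIVEN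
`poitouTate_selmerStructure_duality L`: the multi-place relaxed Kummer count (§1–§2) times the relative local
count (§3). Greenberg's "`corank_{ℤ_p} Sel_E(F_n)_p ≥ r(E,F)pⁿ`" (LNM 1716 p. 62) at finite level `k` in the
relaxed form. [cite: GreenbergLNM1716, Thm 1.7 and the paragraph after it (pp. 61–62)] [cite: MilneADT2006, Ch. I, Thm. 4.10]
[cite: NeukirchSchmidtWingberg2008, (8.7.9)] -/
theorem prime_pow_mul_finrank_le_natCard_kummerOutside_mul (W' : WeierstrassCurve L) [W'.IsElliptic]
    (hPT : poitouTate_selmerStructure_duality L) (v : HeightOneSpectrum (𝓞 F)) (hv : (p : 𝓞 F) ∈ v.asIdeal)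
    (k : ℕ) (T : Finset (HeightOneSpectrum (𝓞 L)))
    (hT : ∀ w : HeightOneSpectrum (𝓞 L), w.asIdeal ∣ v.asIdeal.map (algebraMap (𝓞 F) (𝓞 L)) → w ∈ T) :
    p ^ (k * Module.finrank F L) ≤
      Nat.card (kummerOutside W' (p ^ k) (T.image Sum.inr)) *
        ∏ w : InfinitePlace L, Nat.card (galoisCohomology (W'.localGaloisModule w.Completion) 1) :=
  (prime_pow_mul_finrank_le_prod_natCard_quot p F L v hv k T hT).trans
    (prod_natCard_quot_le_natCard_kummerOutside_mul W' p hPT T k)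

end SideA

/-! ## TRANSPORT §1: place-wise base change of local conditions along `subgroupH1Iso` -/

section Transport

open Summit.BirchSwinnertonDyer.Rank1Residual.Additive
open Summit.BirchSwinnertonDyer.Rank1Residual.Additive.LocalTransport
open Summit.BirchSwinnertonDyer.Rank1Residual.Additive.BaseChange
open Summit.BirchSwinnertonDyer.BirchSwinnertonDyer.Theorems.EtaLayer
open scoped NumberField.LiesOver

variable (L : Type) [Field L] [NumberField L] [Algebra K L] [IsGalois K L]
  {U : Subgroup (Field.absoluteGaloisGroup K)} [U.Normal] (hU : U ≤ galRange (K := K) L)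

omit [W.IsElliptic] [Fact p.Prime] in
/-- **Finite places, place-wise**: if `x ∈ H¹(U^L, E_L[p^∞])` satisfies the classical local condition at
EVERY place `w` of `L` above the finite place `u` of `K` (all `Γ_L`-conjugates), then `subgroupH1Iso x`
satisfies the local condition of `E` at `u` for every `Γ_K`-conjugate (every `K`-embedding `K̄ → K̄_u` has a
package at some `w ∣ u`, EtaLayer file 4; the condition is an iff along a package, file 1). The place-wise
content of `EtaLayer.subgroupH1Iso_mem_localKerOverOfEmb_adicCompletion`. [cite: GreenbergLNM1716, §2]
[cite: NeukirchANT1999, Ch. II §8] -/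
theorem conjH1_subgroupH1Iso_mem_localKerOver_adicCompletion (u : HeightOneSpectrum (𝓞 K))
    (x : (W.baseChange L).subgroupH1 p (comapResGal L U))
    (hx : ∀ w : HeightOneSpectrum (𝓞 L), w.asIdeal.LiesOver u.asIdeal →
      ∀ τ : Field.absoluteGaloisGroup L,
        (W.baseChange L).conjH1 p (comapResGal L U) τ x ∈
          (W.baseChange L).localKerOver p (comapResGal L U) (w.adicCompletion L))
    (σ : Field.absoluteGaloisGroup K) :
    W.conjH1 p U σ (subgroupH1Iso L W p hU x) ∈ W.localKerOver p U (u.adicCompletion K) := by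
  set ι : AlgebraicClosure K →ₐ[K] AlgebraicClosure (u.adicCompletion K) :=
    (closureEmb (K := K) (u.adicCompletion K)).comp
      ((show AlgebraicClosure K ≃ₐ[K] AlgebraicClosure K from σ) :
        AlgebraicClosure K →ₐ[K] AlgebraicClosure K) with hι
  have h : subgroupH1Iso L W p hU x ∈ W.localKerOverOfEmb p U ι := by
    obtain ⟨w, hw, ι₂, ι', hcompat, hf, hfixL⟩ :=
      exists_package_adicCompletion L u (RingEquiv.refl _) (fun _ ↦ rfl) ι
    rw [subgroupH1Iso_mem_localKerOverOfEmb_iff L ι ι₂ ι' hcompat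
      ((adicCompletionMap (K := K) L u w).comp (RingEquiv.refl (u.adicCompletion K)).symm.toRingHom)
      hf W p hU (fun h hh ↦ hfixL h (hU hh)) x]
    obtain ⟨τ, rfl⟩ := exists_algHom_eq_comp (closureEmb (K := L) (w.adicCompletion L)) ι'
    rw [WeierstrassCurve.localKerOverOfEmb_comp, AddSubgroup.mem_comap]
    exact hx w hw _
  rw [hι, W.localKerOverOfEmb_comp p U, AddSubgroup.mem_comap] at h
  rw [WeierstrassCurve.localKerOver_eq_ofEmb]
  exact h

omit [NumberField K] [W.IsElliptic] [Fact p.Prime] in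
/-- **Infinite places, place-wise**: the same at an infinite place `v` of `K`, from the condition at
every infinite place of `L`. [cite: GreenbergLNM1716, §2] -/
theorem conjH1_subgroupH1Iso_mem_localKerOver_infinitePlace [NumberField K] (v : InfinitePlace K)
    (x : (W.baseChange L).subgroupH1 p (comapResGal L U))
    (hx : ∀ (w : InfinitePlace L) (τ : Field.absoluteGaloisGroup L),
        (W.baseChange L).conjH1 p (comapResGal L U) τ x ∈
          (W.baseChange L).localKerOver p (comapResGal L U) w.Completion)
    (σ : Field.absoluteGaloisGroup K) :
    W.conjH1 p U σ (subgroupH1Iso L W p hU x) ∈ W.localKerOver p U v.Completion := by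
  set ι : AlgebraicClosure K →ₐ[K] AlgebraicClosure v.Completion :=
    (closureEmb (K := K) v.Completion).comp
      ((show AlgebraicClosure K ≃ₐ[K] AlgebraicClosure K from σ) :
        AlgebraicClosure K →ₐ[K] AlgebraicClosure K) with hι
  have h : subgroupH1Iso L W p hU x ∈ W.localKerOverOfEmb p U ι := by
    obtain ⟨w, hw, ι₂, ι', hcompat, hf, hfixL⟩ := exists_package_infinitePlace L v ι
    haveI : IsScalarTower K L w.Completion := isScalarTower_completion L w
    rw [subgroupH1Iso_mem_localKerOverOfEmb_iff L ι ι₂ ι' hcompat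
      (LiesOver.completionMap (v := v) (w := w)) hf W p hU (fun h hh ↦ hfixL h (hU hh)) x]
    obtain ⟨τ, rfl⟩ := exists_algHom_eq_comp (closureEmb (K := L) w.Completion) ι'
    rw [WeierstrassCurve.localKerOverOfEmb_comp, AddSubgroup.mem_comap]
    exact hx w _
  rw [hι, W.localKerOverOfEmb_comp p U, AddSubgroup.mem_comap] at h
  rw [WeierstrassCurve.localKerOver_eq_ofEmb]
  exact h

end Transport

/-! ## TRANSPORT §2: the relaxed Kummer classes of `H¹(L, E_L[p^k])` in `H¹(H, E_L[p^∞])` for a full subgroup `H` -/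

section SideB

variable (L : Type) [Field L] [NumberField L] (W' : WeierstrassCurve L) [W'.IsElliptic]

/-- **The relaxed Kummer classes transported to the subgroup model over the same field**: for `H ≤ Γ_L`
containing every element (e.g. `H = res⁻¹(U)` for `U = galRange L`), a finite set `S` of places of `L` and
`k`, the classes `kummerOutside E_L (p^k) S ⊆ H¹(L, E_L[p^k])` map under
`H¹(L, E_L[p^k]) → H¹(L, E_L[p^∞]) ⥲ H¹(⊤, E_L[p^∞]) → H¹(H, E_L[p^∞])` (last two injective) to a finite
set `F` of `p^k`-torsion classes satisfying the local conditions at every place of `L` outside `S`, all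
`Γ_L`-conjugates (conjugation acts trivially on `H¹(H, ·)`), with
`#kummerOutside ≤ #E_L(L̄)[p^∞]^{Γ_L} · #F` (the kernel of the first map is bounded by the finite fixed
points, `finite_ker_resH1Hom_inclusion_and_natCard_le`). Verbatim the level-`0` argument of
`relaxedSelmer_torsion_card_levelZero_of_poitouTate`, for a general full subgroup and a general `S`.
[cite: GreenbergLNM1716, §2 (pp. 62–63), §3 Lemma 3.1] -/
theorem exists_finset_subgroupH1_of_kummerOutside (H : Subgroup (Field.absoluteGaloisGroup L)) [H.Normal]
    (hH : ∀ σ : Field.absoluteGaloisGroup L, σ ∈ H) (S : Finset (Place L)) (k : ℕ) :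
    ∃ F : Finset (W'.subgroupH1 p H),
      (∀ y ∈ F, p ^ k • y = 0 ∧
        (∀ u : HeightOneSpectrum (𝓞 L), (Sum.inr u : Place L) ∉ S →
          ∀ σ : Field.absoluteGaloisGroup L,
            W'.conjH1 p H σ y ∈ W'.localKerOver p H (u.adicCompletion L)) ∧
        (∀ w : InfinitePlace L, (Sum.inl w : Place L) ∉ S →
          ∀ σ : Field.absoluteGaloisGroup L,
            W'.conjH1 p H σ y ∈ W'.localKerOver p H w.Completion)) ∧
      Nat.card (kummerOutside W' (p ^ k) S) ≤
        Nat.card {m : W'.geomPrimaryTorsion p | ∀ σ : Field.absoluteGaloisGroup L, σ • m = m} * F.card := by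
  classical
  set Fix := {m : W'.geomPrimaryTorsion p | ∀ σ : Field.absoluteGaloisGroup L, σ • m = m} with hFix
  haveI hFixfin : Finite Fix := (W'.finite_fixedPoints_geomPrimaryTorsion p).to_subtype
  haveI : NeZero (p ^ k) := ⟨pow_ne_zero k (Fact.out : p.Prime).ne_zero⟩
  haveI : Finite (W'.geomTorsion ((p ^ k : ℕ) : ℤ)) := finite_geomTorsion_of_neZero W' _
  have hle : H ≤ ⊤ := le_top
  have hge : (⊤ : Subgroup (Field.absoluteGaloisGroup L)) ≤ H := fun σ _ ↦ hH σ
  let ι₁ : galoisCohomology (W'.torsionGaloisModule ((p ^ k : ℕ) : ℤ)) 1 →+ W'.galH1Primary p :=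
    resH1Hom (ContinuousMonoidHom.id (Field.absoluteGaloisGroup L))
      (AddSubgroup.inclusion
        (Literature.Barriers.BirchSwinnertonDyer.geomTorsion_pow_le_geomPrimaryTorsion W' p k))
      (fun _ _ ↦ rfl)
  let ι₂ : W'.galH1Primary p →+ W'.subgroupH1 p ⊤ :=
    resH1Hom (Literature.NumberTheory.EllipticCurves.subgroupIncl (⊤ : Subgroup (Field.absoluteGaloisGroup L)))
      (AddMonoidHom.id (W'.geomPrimaryTorsion p)) (fun _ _ ↦ rfl)
  let ι₃ : W'.subgroupH1 p ⊤ →+ W'.subgroupH1 p H := W'.resOfLe p hle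
  let Φ : galoisCohomology (W'.torsionGaloisModule ((p ^ k : ℕ) : ℤ)) 1 →+ W'.subgroupH1 p H :=
    ι₃.comp (ι₂.comp ι₁)
  have hΦ : ∀ x, Φ x = ι₃ (ι₂ (ι₁ x)) := fun _ ↦ rfl
  have hι₂ : Function.Injective ι₂ := (bijective_resH1Hom_subgroupIncl _ ⊤ Subgroup.mem_top).1
  have hι₃ : Function.Injective ι₃ := resOfLe_injective_of_ge (W'.geomPrimaryTorsion p) hle hge
  -- the source: relaxed Kummer classes at level `p^k`
  set KO := kummerOutside W' (p ^ k) S with hKO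
  haveI hKOfin : Finite KO := finite_kummerOutside W' (p ^ k) S
  have hKOfin' : (KO : Set (galoisCohomology (W'.torsionGaloisModule ((p ^ k : ℕ) : ℤ)) 1)).Finite :=
    Set.toFinite _
  set s : Finset (galoisCohomology (W'.torsionGaloisModule ((p ^ k : ℕ) : ℤ)) 1) := hKOfin'.toFinset with hs
  have hsmem : ∀ x, x ∈ s ↔ x ∈ KO := fun x ↦ by rw [hs, Set.Finite.mem_toFinset]; rfl
  refine ⟨s.image Φ, fun y hy ↦ ?_, ?_⟩
  · obtain ⟨x, hx, rfl⟩ := Finset.mem_image.mp hy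
    have hxKO : x ∈ KO := (hsmem x).mp hx
    have hxloc := (mem_kummerOutside_iff W' (p ^ k) S x).mp hxKO
    -- local kernels at every place outside `S`
    have hker : ∀ pl : Place L, pl ∉ S → ι₂ (ι₁ x) ∈ W'.localKerOver p ⊤ (Place.Completion pl) := by
      intro pl hpl
      rw [WeierstrassCurve.resH1Hom_subgroupIncl_mem_localKerOver_top_iff]
      refine resH1Hom_inclusion_mem_selmerLocalKerPrimary W' p k (Place.Completion pl) ?_
      have h1 := hxloc pl hpl
      rw [← W'.comap_res_kummerLocalConditionAt ((p ^ k : ℕ) : ℤ) (Place.Completion pl)]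
      exact h1
    have hconj : ∀ σ : Field.absoluteGaloisGroup L, W'.conjH1 p H σ (Φ x) = Φ x := fun σ ↦ by
      rw [W'.conjH1_of_mem_holds p H (hH σ), AddMonoidHom.id_apply]
    refine ⟨?_, fun u hu σ ↦ ?_, fun w hw σ ↦ ?_⟩
    · have hx0 : p ^ k • x = 0 :=
        nsmul_continuousCohomology_one_eq_zero _ (p ^ k)
          (fun T : W'.geomTorsion ((p ^ k : ℕ) : ℤ) ↦ AddSubgroup.torsionBy.nsmul T) x
      rw [← map_nsmul, hx0, map_zero]
    · rw [hconj, hΦ]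
      exact W'.resOfLe_mem_localKerOver p _ hle (hker (Sum.inr u) hu)
    · rw [hconj, hΦ]
      exact W'.resOfLe_mem_localKerOver p _ hle (hker (Sum.inl w) hw)
  · -- the count: `#KO ≤ #(ker ι₁) · #image` (fibres = cosets of `ker ι₁`), `#ker ι₁ ≤ #Fix`
    obtain ⟨hkerfin, hkerle⟩ := finite_ker_resH1Hom_inclusion_and_natCard_le W' p k
    haveI : Finite ι₁.ker := hkerfin
    have hkerle' : Nat.card ι₁.ker ≤ Nat.card Fix := hkerle
    have hscard : s.card = Nat.card KO := by
      rw [hs, ← Set.ncard_eq_toFinset_card _ hKOfin']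
      exact (Nat.card_coe_set_eq _).symm
    have hfib : ∀ b ∈ s.image Φ, (s.filter fun x ↦ Φ x = b).card ≤ Nat.card ι₁.ker := by
      intro b hb
      obtain ⟨x₀, -, rfl⟩ := Finset.mem_image.mp hb
      rw [← Nat.card_eq_finsetCard]
      refine Nat.card_le_card_of_injective
        (fun x ↦ (⟨x.1 - x₀, ?_⟩ : ι₁.ker)) ?_
      · have hx := (Finset.mem_filter.mp x.2).2
        have h1 : ι₁ x.1 = ι₁ x₀ := hι₂ (hι₃ (by rw [← hΦ, ← hΦ, hx]))
        exact (AddMonoidHom.mem_ker).mpr (by rw [map_sub, h1, sub_self])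
      · intro x y h
        have h1 : x.1 - x₀ = y.1 - x₀ := congrArg Subtype.val h
        exact Subtype.ext (sub_left_injective h1)
    have hsle : s.card ≤ Nat.card ι₁.ker * (s.image Φ).card := Finset.card_le_mul_card_image s _ hfib
    calc Nat.card KO = s.card := hscard.symm
      _ ≤ Nat.card ι₁.ker * (s.image Φ).card := hsle
      _ ≤ Nat.card Fix * (s.image Φ).card := Nat.mul_le_mul_right _ hkerle'

end SideB

/-! ## TRANSPORT §3: (I1) at every layer from Poitou–Tate over the layers -/

section AllLevels

open Summit.BirchSwinnertonDyer.Rank1Residual.Additive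
open Summit.BirchSwinnertonDyer.Rank1Residual.Additive.BaseChange
open Summit.BirchSwinnertonDyer.Rank1Residual.Additive.ZpTower

/-- **(I1) `WeierstrassCurve.relaxedSelmer_torsion_card_growth` FROM POITOU–TATE FOR SELMER STRUCTURES (all number fields,
all `ℤ_p`-extensions, all `v ∋ p`, ALL LAYERS).** GIVEN `poitouTate_selmerStructure_duality L` for every number field `L`
(Milne ADT I Thm. 4.10 / Howard 2004 Thm. 2.1.11; used only for the layers `L = K_n`), Greenberg's finite-level count holds
VERBATIM with `c(n) = #E(K̄)[p^∞]^{Γ_{K_n}} · ∏_{w ∣ ∞ of K_n} #H¹(K_{n,w}, E)`: Side A over `L = κ.layer n` relaxed exactly above `v`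
(§0, `[K_n:K] = pⁿ`), moved into `H¹(res⁻¹(κ⁻¹(pⁿℤ_p)), E_L[p^∞])` (§2; the SEAM `galRange K_n = κ.layerSubgroup n` makes `res⁻¹`
everything), then along `subgroupH1Iso` into `H¹(κ.layerSubgroup n, E[p^∞])` with the local conditions transported place-wise
(§1; a place `w ∣ u` of `K_n` is not above `v` when `u ≠ v`). Discharges the hypothesis `hI1` of `…H1SigmaNotTorsionOfRelaxed`,
`…OfPubTwoRelaxed`, `…OfPubThreeNotTorsion`, `…H1SigmaDualNotTorsionAdapters` and of `not_isTorsion_of_supersingular_holds_of`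
modulo the ONE generic fact PT. [cite: GreenbergLNM1716, Thm 1.7 and the paragraph after it (pp. 61–62), §2, §3 Lemma 3.1]
[cite: MilneADT2006, Ch. I, Thm. 4.10] [cite: NeukirchSchmidtWingberg2008, (8.7.9)] [cite: Washington1997, §13.1] -/
theorem relaxedSelmer_torsion_card_growth_of_poitouTate
    (hPT : ∀ (L : Type) [Field L] [NumberField L], poitouTate_selmerStructure_duality L) :
    WeierstrassCurve.relaxedSelmer_torsion_card_growth.{0} := by
  intro K _ _ W _ p _ κ v hpv
  classical
  refine ⟨fun n ↦ Nat.card {m : (W.baseChange (κ.layer n)).geomPrimaryTorsion p |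
      ∀ σ : Field.absoluteGaloisGroup (κ.layer n), σ • m = m} *
    ∏ w : InfinitePlace (κ.layer n),
      Nat.card (galoisCohomology ((W.baseChange (κ.layer n)).localGaloisModule w.Completion) 1),
    fun n k ↦ ?_⟩
  haveI : PerfectField K := PerfectField.ofCharZero
  -- the layer `L = K_n` and the seam
  set U : Subgroup (Field.absoluteGaloisGroup K) := κ.layerSubgroup n with hUdef
  have hseam : galRange (K := K) (κ.layer n) = U := galRange_layer_eq_layerSubgroup κ n
  have hU : U ≤ galRange (K := K) (κ.layer n) := hseam.ge
  have hH : ∀ τ : Field.absoluteGaloisGroup (κ.layer n), τ ∈ comapResGal (κ.layer n) U := fun τ ↦ by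
    rw [mem_comapResGal_iff, ← hseam]
    exact ⟨τ, rfl⟩
  have hfinrank : Module.finrank K (κ.layer n) = p ^ n := κ.finrank_layer_holds n
  -- the places of `K_n` above `v`
  set I₁ : Ideal (𝓞 (κ.layer n)) := v.asIdeal.map (algebraMap (𝓞 K) (𝓞 (κ.layer n))) with hI₁def
  have hI₁ : I₁ ≠ ⊥ := by
    rw [hI₁def, Ne, Ideal.map_eq_bot_iff_of_injective (algebraMap_ringOfIntegers_injective K (κ.layer n))]
    exact v.ne_bot
  set T : Finset (HeightOneSpectrum (𝓞 (κ.layer n))) := (Ideal.finite_factors hI₁).toFinset with hTdef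
  have hTmem : ∀ w : HeightOneSpectrum (𝓞 (κ.layer n)), w ∈ T ↔ w.asIdeal ∣ I₁ := fun w ↦ by
    rw [hTdef, Set.Finite.mem_toFinset]
    rfl
  have hT : ∀ w : HeightOneSpectrum (𝓞 (κ.layer n)), w.asIdeal ∣ I₁ → w ∈ T := fun w hw ↦
    (hTmem w).mpr hw
  have hTv : ∀ w ∈ T, w.asIdeal.LiesOver v.asIdeal := fun w hw ↦
    liesOver_of_dvd_map K (κ.layer n) v w ((hTmem w).mp hw)
  -- Side A over `K_n`, transported to `H¹(res⁻¹ U, E_{K_n}[p^∞])`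
  obtain ⟨F, hF, hcount⟩ := exists_finset_subgroupH1_of_kummerOutside p (κ.layer n) (W.baseChange (κ.layer n))
    (comapResGal (κ.layer n) U) hH (T.image Sum.inr) k
  have hA := prime_pow_mul_finrank_le_natCard_kummerOutside_mul p K (κ.layer n) (W.baseChange (κ.layer n))
    (hPT (κ.layer n)) v hpv k T hT
  -- transport to `H¹(U, E[p^∞])`
  let Ψ := subgroupH1Iso (κ.layer n) W p hU
  refine ⟨F.image Ψ, fun y hy ↦ ?_, ?_⟩
  · obtain ⟨x, hx, rfl⟩ := Finset.mem_image.mp hy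
    obtain ⟨hx0, hxfin, hxinf⟩ := hF x hx
    refine ⟨by rw [← map_nsmul, hx0, map_zero], fun u hu σ ↦ ?_, fun w σ ↦ ?_⟩
    · refine conjH1_subgroupH1Iso_mem_localKerOver_adicCompletion W p (κ.layer n) hU u x ?_ σ
      intro w hw τ
      refine hxfin w (fun hmem ↦ ?_) τ
      have hwT : w ∈ T := (inr_mem_image_inr_iff T w).mp hmem
      have h1 : w.asIdeal.LiesOver v.asIdeal := hTv w hwT
      apply hu
      apply HeightOneSpectrum.ext
      rw [hw.over, h1.over]
    · exact conjH1_subgroupH1Iso_mem_localKerOver_infinitePlace W p (κ.layer n) hU w x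
        (fun w' τ ↦ hxinf w' (inl_not_mem_image_inr T w') τ) σ
  · rw [Finset.card_image_of_injective F Ψ.injective, ← hfinrank]
    calc p ^ (k * Module.finrank K (κ.layer n))
        ≤ Nat.card (kummerOutside (W.baseChange (κ.layer n)) (p ^ k) (T.image Sum.inr)) *
          ∏ w : InfinitePlace (κ.layer n),
            Nat.card (galoisCohomology ((W.baseChange (κ.layer n)).localGaloisModule w.Completion) 1) := hA
      _ ≤ (Nat.card {m : (W.baseChange (κ.layer n)).geomPrimaryTorsion p |
            ∀ σ : Field.absoluteGaloisGroup (κ.layer n), σ • m = m} * F.card) *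
          ∏ w : InfinitePlace (κ.layer n),
            Nat.card (galoisCohomology ((W.baseChange (κ.layer n)).localGaloisModule w.Completion) 1) :=
          Nat.mul_le_mul_right _ hcount
      _ = _ := by ring

end AllLevels


/-! ## §4 Corollaries by name: Greenberg Thm. 1.7 (supersingular case) and the K4 door predicate, from PT over the layers -/

section Corollaries

open Literature.NumberTheory.EllipticCurves.ZpExtension WeierstrassCurve
  Literature.NumberTheory.EllipticCurves.IwasawaDual Literature.NumberTheory.EllipticCurves.IwasawaAlgebra
  Literature.NumberTheory.EllipticCurves.GreenbergVatsal2000 Literature.NumberTheory.EllipticCurves.Rank1Residual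

omit [W.IsElliptic] in
/-- **Greenberg's Thm. 1.7 (supersingular case) from PT over the layers and Coates–Greenberg (I2)**: for any
Pontryagin-dual datum `D` of `Sel_{p^∞}(E/K_∞)`, `D.not_isTorsion_of_supersingular` (the tree's rendering of
`X(E/K_∞)` not `Λ`-torsion at a supersingular `v ∣ p`, `κ` cyclotomic) — the tree assembly
`SelmerDualData.not_isTorsion_of_supersingular_holds_of (I2) (I1)` with (I1) discharged by §3.
[cite: GreenbergLNM1716, Thm 1.7 (pp. 61–62) and §2 (p. 84)] [cite: CoatesGreenberg1996, Cor. 3.2] -/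
theorem not_isTorsion_of_supersingular_of_poitouTate
    (hPT : ∀ (L : Type) [Field L] [NumberField L], poitouTate_selmerStructure_duality L)
    (h2 : WeierstrassCurve.CoatesGreenberg1996_H1_formalGroup_trivial.{0})
    {κ : ZpExtension K p} {γ : Field.absoluteGaloisGroup K} (D : SelmerDualData W κ γ) :
    D.not_isTorsion_of_supersingular :=
  D.not_isTorsion_of_supersingular_holds_of h2 (relaxedSelmer_torsion_card_growth_of_poitouTate hPT)

/-- **The K4 door predicate `H1SigmaDualNotTorsion` from PT over the layers, for EVERY curve** (any number field
`K : Type`, cyclotomic `κ` with topological generator `γ`, good reduction off `S₀ ∪ {u ∣ p}`; no `E(K)[p] = 0`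
hypothesis, unlike the twist road): `h1SigmaDualNotTorsion_of_relaxedCount` with (I1) discharged by §3.
[cite: GreenbergLNM1716, §4 p. 113, §1 p. 62, §3 Lemma 3.1] [cite: MilneADT2006, Ch. I, Thm. 4.10] -/
theorem h1SigmaDualNotTorsion_of_poitouTate_layers
    (hPT : ∀ (L : Type) [Field L] [NumberField L], poitouTate_selmerStructure_duality L)
    (κ : ZpExtension K p) {γ : Field.absoluteGaloisGroup K} (hκ : κ.IsCyclotomic) (hγ : κ.IsTopGenerator γ)
    {S₀ : Set (HeightOneSpectrum (𝓞 K))}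
    (hgood : ∀ u : HeightOneSpectrum (𝓞 K), u ∉ S₀ → ((p : ℕ) : 𝓞 K) ∉ u.asIdeal → W.HasGoodReductionAt u)
    {v : HeightOneSpectrum (𝓞 K)} (hpv : (p : 𝓞 K) ∈ v.asIdeal) :
    H1SigmaDualNotTorsion W p κ γ S₀ :=
  h1SigmaDualNotTorsion_of_relaxedCount W κ hκ hγ hgood hpv (relaxedSelmer_torsion_card_growth_of_poitouTate hPT)

end Corollaries

end Summit.BirchSwinnertonDyer.BirchSwinnertonDyer.Theorems.SignedEC.RelaxedKummerCount

end
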